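import Mathlib.NumberTheory.AbelSummation
import Mathlib.NumberTheory.Chebyshev
import Mathlib.Analysis.SpecialFunctions.Log.NegMulLog
import Literature.NumberTheory.LFunctions.TwistedVonMangoldtSum
import Literature.NumberTheory.LFunctions.SiegelWalfiszMoebiusProofs
import Literature.NumberTheory.Sieve.MoebiusShiftedPrimesMinorArcWith
import Literature.NumberTheory.Sieve.MoebiusShiftedPrimesAvgFinal
import HarnessLib

/-!
# Lichtman 2020, Lemma 4.5 (Vinogradov–Korobov bound for prime character sums) from Khale's theorem

Topic `Literature/NumberTheory/Sieve`.  Everything in this file is PROVED.  It derives the named fact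
`Literature.NumberTheory.Sieve.Lichtman2020_primeCharacterSum` (Lichtman, arXiv:2009.08969, Lemma 4.5:
for `q ≤ (log X)^A`, `exp((log X)^θ) ≤ P ≤ Q ≤ X`, `|t| ≤ X`,
`|∑_{P ≤ p ≤ Q} χ(p) p^{-1-it}| ≪_{A,K,θ} log X/(1 + |t|) + (log X)^{-K}`) from the one remaining
printed input, the Vinogradov–Korobov zero-free region for Dirichlet `L`-functions in Khale's
explicit form (`Literature.NumberTheory.LFunctions.Khale2024_zeroFreeRegion`,
`VinogradovKorobovDirichlet.lean`):

* `Lichtman2020.PrimeCharSum.Lichtman2020_primeCharacterSum_of_khale :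
    Khale2024_zeroFreeRegion → Lichtman2020_primeCharacterSum`,

and, more generally, from ANY Vinogradov–Korobov region in the inexplicit interface of
`VinogradovKorobovDirichlet.lean` (`HasVKZeroFreeRegion c T₀`: `L(σ + it, χ) ≠ 0` for `q ≥ 3`,
`|t| ≥ T₀`, `σ ≥ 1 − c/(log q + (log|t|)^{2/3}(log log|t|)^{1/3})`; Khale's theorem is the case
`c = 1/61.5`, `T₀ = 10`, `hasVKZeroFreeRegion_of_khale`):

* `Lichtman2020.PrimeCharSum.Lichtman2020_primeCharacterSum_of_vk (hc : 0 < c)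
    (hVK : HasVKZeroFreeRegion c T₀) : Lichtman2020_primeCharacterSum`
  (through `TwistedVonMangoldt.twisted_sum_estimate_of_vk`; the `_of_khale` forms are its one-line
  specialisations), so that an inexplicit proof of the region — Vinogradov's method with unspecified
  constants — discharges Lemma 4.5 and everything downstream
  (`lichtman2020_moebius_shifted_primes_avg_power_of_vk`, `lichtman2020_moebius_shifted_primes_avg_of_vk`),

and records the resulting form of the main theorem of the paper.  Lemma 4.8 of the paper is no longer
a printed input of the tree: it is proved from the Siegel–Walfisz theorem for `μ`
(`Lichtman2020_liouvilleCharacterSifted_of_siegelWalfiszMoebius`, `LiouvilleSiftedCharSum.lean`), and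
that theorem is itself proved (`Literature.NumberTheory.LFunctions.SiegelWalfiszMoebius_holds`,
`SiegelWalfiszMoebiusProofs.lean`, Montgomery–Vaughan §11.3 Exercises 8 and 13).  Hence:

* `lichtman2020_moebius_shifted_primes_avg_power_of_khale_of_siegelWalfiszMoebius (hK) (hSW)`,
  `lichtman2020_moebius_shifted_primes_avg_of_khale_of_siegelWalfiszMoebius (hK) (hSW)` — Theorem 1.1
  (power range, resp. qualitative part) from Khale's Theorem 1.1 and Siegel–Walfisz for `μ` (the
  closing statements of `MoebiusShiftedPrimesAvgFinal.lean` with Lemma 4.5 supplied here);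
* `Lichtman2020_liouvilleCharacterSifted_holds` — Lemma 4.8, PROVED (the two theorems above);
* `lichtman2020_moebius_shifted_primes_avg_power_of_khale (hK)`,
  `lichtman2020_moebius_shifted_primes_avg_of_khale (hK)` — **both named facts vendoring Theorem 1.1
  follow from ONE printed theorem not proved in the tree**, Khale's explicit Vinogradov–Korobov
  region for Dirichlet `L`-functions (`Khale2024_zeroFreeRegion`), whose own proof (Ford's zero
  detector and the Richert–Ford bound for the Hurwitz zeta function) is the remaining frontier — the
  same frontier as the tree's Vinogradov–Korobov region for `ζ`, which rests on Ford's named bound.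

(The older conditional form `…_of_khale_of_liouvilleCharacterSifted (hK) (h48)` through
`MoebiusShiftedPrimesMinorArcWith.lean` is kept as well.)

## The argument

Lichtman's proof of Lemma 4.5 is "as with [MR15, Lemma 2], with the Vinogradov–Korobov region of
`L(s, χ)` in place of that of `ζ`".  The twisted prime number theorem
`U(x) = ∑_{n ≤ x} χ(n)Λ(n)n^{-it} = δ_χ x^{1−it}/(1 − it) + O((log X)^{-K-2} x)` for
`exp((log X)^θ)/2 ≤ x ≤ X` is `TwistedVonMangoldt.twisted_sum_estimate`.  Passing to primes costs
`ψ(x) − ϑ(x) ≤ 2√x log x` (Mathlib), so the prime sums `D(u) = ∑_{p ≤ u} χ(p) log p · p^{-it}` satisfy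
`|D(u)| ≤ κ u`, `κ = 2/(1 + |t|) + 2(log X)^{-K-2}` (`|1 − it| ≥ (1 + |t|)/2`).  Abel summation
(Mathlib's `sum_mul_eq_sub_sub_integral_mul'`) with `f(u) = 1/(u log u)` on `[⌈P⌉ − 1, ⌊Q⌋]` gives
`S = f(m)D(m) − f(n)D(n) − ∫ₙᵐ f'(u) D(u) du` (`n = ⌈P⌉ − 1`, `m = ⌊Q⌋`); the boundary terms are each
`≤ κ/log n`, and `|f'(u)| = (log u + 1)/(u log u)² ≤ 2/(u² log u) ≤ 2/(u² log n)` (`log u ≥ log n ≥ 1`,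
`norm_deriv_weight_le`) gives `|f'(u) D(u)| ≤ 2κ/(u log n)`, so
`|∫| ≤ (2κ/log n) log(m/n) ≤ 2κ log X/log n`; whence `|S| ≤ 2κ/log n + 2κ log X/log n ≤ 4κ log X/log n
≤ 8κ (log X)^{1−θ} ≤ 16 (log X/(1 + |t|) + (log X)^{-K})` for `X` large (`log n ≥ (log X)^θ/2`);
small `X` are absorbed by the trivial bound `|S| ≤ X`.

## References

* J. D. Lichtman, *Averages of the Möbius function on shifted primes*, Q. J. Math. (2021),
  arXiv:2009.08969, Lemma 4.5. [Lichtman2020]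
* K. Matomäki, M. Radziwiłł, *A note on the Liouville function in short intervals*, arXiv:1502.02374,
  Lemma 2.
* T. Khale, Q. J. Math. 75 (2024), 299–332, Theorem 1.1. [Khale2024]
* H. L. Montgomery, R. C. Vaughan, *Multiplicative Number Theory I*, §11.3 Exercises 8, 13
  (Siegel–Walfisz for `μ`). [MontgomeryVaughan2007]
-/

noncomputable section

open Complex Filter Topology MeasureTheory
open scoped ArithmeticFunction.vonMangoldt

namespace Literature.NumberTheory.Sieve

namespace Lichtman2020.PrimeCharSum

open Literature.NumberTheory.LFunctions Literature.NumberTheory.LFunctions.TwistedVonMangoldt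

variable {q : ℕ} [NeZero q]

/-! ### The prime coefficients `c(k) = χ(k) log k · k^{-it}` -/

/-- `c(k) = χ(k) log k · k^{-it}` for prime `k`, `0` otherwise. [cite: Lichtman2020, Lemma 4.5 (proof)] -/
def primeCoeff (χ : DirichletCharacter ℂ q) (t : ℝ) : ℕ → ℂ :=
  fun k ↦ if k.Prime then χ k * (Real.log k : ℂ) * (k : ℂ) ^ (-(t * I)) else 0

omit [NeZero q] in
/-- At a prime, `c(p) = χ(p)Λ(p)p^{-it}` is the twisted von Mangoldt coefficient. [folklore] -/
theorem primeCoeff_of_prime (χ : DirichletCharacter ℂ q) (t : ℝ) {k : ℕ} (hk : k.Prime) :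
    primeCoeff χ t k = twist χ t k := by
  simp [primeCoeff, twist, hk, ArithmeticFunction.vonMangoldt_apply_prime hk]

omit [NeZero q] in
/-- At a non-prime, `c(k) = 0`. [folklore] -/
theorem primeCoeff_of_not_prime (χ : DirichletCharacter ℂ q) (t : ℝ) {k : ℕ} (hk : ¬ k.Prime) :
    primeCoeff χ t k = 0 := by
  simp [primeCoeff, hk]

omit [NeZero q] in
/-- **Passing to primes**: `‖∑_{k ≤ u} χ(k)Λ(k)k^{-it} − ∑_{k ≤ u} c(k)‖ ≤ ψ(u) − ϑ(u)` (the difference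
is the sum of the twisted coefficients over the non-primes `k ≤ u`, dominated by `Λ`).
[cite: Lichtman2020, Lemma 4.5 (proof)] -/
theorem norm_sum_twist_sub_sum_primeCoeff_le (χ : DirichletCharacter ℂ q) (t u : ℝ) :
    ‖∑ k ∈ Finset.Ioc 0 ⌊u⌋₊, twist χ t k - ∑ k ∈ Finset.Ioc 0 ⌊u⌋₊, primeCoeff χ t k‖ ≤
      Chebyshev.psi u - Chebyshev.theta u := by
  rw [Chebyshev.psi_sub_theta_eq_sum_not_prime, ← Finset.sum_sub_distrib]
  have h : ∑ k ∈ Finset.Ioc 0 ⌊u⌋₊, (twist χ t k - primeCoeff χ t k) =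
      ∑ k ∈ (Finset.Ioc 0 ⌊u⌋₊).filter (fun k ↦ ¬ k.Prime), twist χ t k := by
    rw [Finset.sum_filter]
    refine Finset.sum_congr rfl fun k _ ↦ ?_
    by_cases hk : k.Prime
    · simp [hk, primeCoeff_of_prime χ t hk]
    · simp [hk, primeCoeff_of_not_prime χ t hk]
  rw [h]
  exact (norm_sum_le _ _).trans (Finset.sum_le_sum fun k _ ↦ norm_twist_le χ t k)

/-- `‖1 − it‖ ≥ (1 + |t|)/2`. [folklore] -/
theorem norm_one_sub_mul_I_ge (t : ℝ) : (1 + |t|) / 2 ≤ ‖(1 : ℂ) - t * I‖ := by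
  have h1 : (1 : ℝ) ≤ ‖(1 : ℂ) - t * I‖ := by
    have := Complex.re_le_norm ((1 : ℂ) - t * I); simpa using this
  have h2 : |t| ≤ ‖(1 : ℂ) - t * I‖ := by
    have := Complex.abs_im_le_norm ((1 : ℂ) - t * I); simpa using this
  linarith

/-- **The prime sums `D(u) = ∑_{p ≤ u} χ(p) log p · p^{-it}` are `≤ κ u`**: if
`‖U(u) − δ u^a/a‖ ≤ εu` (`a = 1 − it`, `|δ| ≤ 1`) and `ψ(u) − ϑ(u) ≤ εu` then
`‖∑_{k ∈ [0, u]} c(k)‖ ≤ (2/(1 + |t|) + 2ε) u`. [cite: Lichtman2020, Lemma 4.5 (proof)] -/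
theorem norm_sum_primeCoeff_le (χ : DirichletCharacter ℂ q) (t : ℝ) {u ε : ℝ} (hu : 0 < u)
    (htw : ‖∑ k ∈ Finset.Ioc 0 ⌊u⌋₊, twist χ t k -
      delta χ * (u : ℂ) ^ (1 - t * I) / (1 - t * I)‖ ≤ ε * u)
    (hψθ : Chebyshev.psi u - Chebyshev.theta u ≤ ε * u) :
    ‖∑ k ∈ Finset.Icc 0 ⌊u⌋₊, primeCoeff χ t k‖ ≤ (2 / (1 + |t|) + 2 * ε) * u := by
  have h0 : ∑ k ∈ Finset.Icc 0 ⌊u⌋₊, primeCoeff χ t k = ∑ k ∈ Finset.Ioc 0 ⌊u⌋₊, primeCoeff χ t k := by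
    rw [← Finset.Ioc_insert_left (Nat.zero_le _), Finset.sum_insert (by simp),
      primeCoeff_of_not_prime χ t Nat.not_prime_zero, zero_add]
  rw [h0]
  set U : ℂ := ∑ k ∈ Finset.Ioc 0 ⌊u⌋₊, twist χ t k with hU
  set D : ℂ := ∑ k ∈ Finset.Ioc 0 ⌊u⌋₊, primeCoeff χ t k with hD
  set a : ℂ := 1 - t * I with ha
  set M : ℂ := delta χ * (u : ℂ) ^ a / a with hM
  have hdiff := norm_sum_twist_sub_sum_primeCoeff_le χ t u
  rw [← hU, ← hD] at hdiff
  -- the main term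
  have ha0 : (1 + |t|) / 2 ≤ ‖a‖ := norm_one_sub_mul_I_ge t
  have hapos : 0 < ‖a‖ := lt_of_lt_of_le (by positivity) ha0
  have hMle : ‖M‖ ≤ 2 / (1 + |t|) * u := by
    have hua : ‖(u : ℂ) ^ a‖ = u := by
      rw [Complex.norm_cpow_eq_rpow_re_of_pos hu]; simp [ha]
    rw [hM, norm_div, norm_mul, hua]
    calc ‖delta χ‖ * u / ‖a‖ ≤ 1 * u / ‖a‖ := by
          gcongr; exact norm_delta_le χ
      _ ≤ 1 * u / ((1 + |t|) / 2) := div_le_div_of_nonneg_left (by positivity) (by positivity) ha0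
      _ = 2 / (1 + |t|) * u := by field_simp
  calc ‖D‖ = ‖(U - M) + M - (U - D)‖ := by ring_nf
    _ ≤ ‖U - M‖ + ‖M‖ + ‖U - D‖ := by
        calc _ ≤ ‖(U - M) + M‖ + ‖U - D‖ := norm_sub_le _ _
          _ ≤ _ := by gcongr; exact norm_add_le _ _
    _ ≤ ε * u + 2 / (1 + |t|) * u + ε * u := by linarith [htw, hMle, hdiff.trans hψθ]
    _ = (2 / (1 + |t|) + 2 * ε) * u := by ring

/-! ### The weight `f(u) = 1/(u log u)` -/

/-- The real weight `f(u) = (u log u)⁻¹`. [folklore] -/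
def weight (u : ℝ) : ℝ := (u * Real.log u)⁻¹

/-- `f` has derivative `−(log u + 1)/(u log u)²` at `u > 1`. [folklore] -/
theorem hasDerivAt_weight {u : ℝ} (hu : 1 < u) :
    HasDerivAt weight (-(Real.log u + 1) / (u * Real.log u) ^ 2) u := by
  have hu0 : u ≠ 0 := by linarith
  have hlog : 0 < Real.log u := Real.log_pos hu
  have hne : u * Real.log u ≠ 0 := mul_ne_zero hu0 hlog.ne'
  have h := (Real.hasDerivAt_mul_log hu0).inv hne
  unfold weight
  exact h

/-- The complex weight `u ↦ (f(u) : ℂ)` has derivative `−(log u + 1)/(u log u)²` at `u > 1`. [folklore] -/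
theorem hasDerivAt_weightC {u : ℝ} (hu : 1 < u) :
    HasDerivAt (fun u : ℝ ↦ (weight u : ℂ)) (((-(Real.log u + 1) / (u * Real.log u) ^ 2 : ℝ) : ℂ)) u :=
  (hasDerivAt_weight hu).ofReal_comp

/-- `|f'(u)| ≤ 2/(u² log u)` for `log u ≥ 1` (`(log u + 1)/(u log u)² ≤ 2 log u/(u log u)²`). [folklore] -/
theorem norm_deriv_weight_le {u : ℝ} (hu : 1 < u) (hlog : 1 ≤ Real.log u) :
    ‖(((-(Real.log u + 1) / (u * Real.log u) ^ 2 : ℝ)) : ℂ)‖ ≤ 2 / (u ^ 2 * Real.log u) := by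
  have hu0 : 0 < u := by linarith
  have hl0 : 0 < Real.log u := by linarith
  rw [Complex.norm_real, Real.norm_eq_abs, abs_div, abs_neg, abs_of_pos (by positivity : 0 < Real.log u + 1),
    abs_of_pos (by positivity : 0 < (u * Real.log u) ^ 2), div_le_div_iff₀ (by positivity) (by positivity)]
  have hul : 0 < u ^ 2 * Real.log u := by positivity
  have h2 : Real.log u + 1 ≤ 2 * Real.log u := by linarith
  calc (Real.log u + 1) * (u ^ 2 * Real.log u) ≤ 2 * Real.log u * (u ^ 2 * Real.log u) :=
        mul_le_mul_of_nonneg_right h2 hul.le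
    _ = 2 * (u * Real.log u) ^ 2 := by ring

/-! ### The prime sum as an Abel sum -/

omit [NeZero q] in
/-- `∑_{P ≤ p ≤ Q} χ(p) p^{-1-it} = ∑_{k ∈ (⌈P⌉ − 1, ⌊Q⌋]} f(k) c(k)` with `f(u) = 1/(u log u)`,
`c(k) = χ(k) log k · k^{-it} 𝟙_{k prime}` (`P > 0`). [cite: Lichtman2020, Lemma 4.5 (proof)] -/
theorem sum_primes_eq_sum_weight_mul (χ : DirichletCharacter ℂ q) (t : ℝ) {P : ℝ} (hP : 0 < P)
    (Q : ℝ) :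
    ∑ p ∈ (Finset.Icc ⌈P⌉₊ ⌊Q⌋₊).filter Nat.Prime, χ (p : ZMod q) * (p : ℂ) ^ (-(1 + (t : ℂ) * I)) =
      ∑ k ∈ Finset.Ioc (⌈P⌉₊ - 1) ⌊Q⌋₊, ((weight k : ℝ) : ℂ) * primeCoeff χ t k := by
  have hn1 : 1 ≤ ⌈P⌉₊ := Nat.ceil_pos.2 hP
  have hIcc : Finset.Icc ⌈P⌉₊ ⌊Q⌋₊ = Finset.Ioc (⌈P⌉₊ - 1) ⌊Q⌋₊ := by
    conv_lhs => rw [show ⌈P⌉₊ = (⌈P⌉₊ - 1) + 1 from (Nat.sub_add_cancel hn1).symm]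
    exact Finset.Icc_add_one_left_eq_Ioc _ _
  rw [hIcc, Finset.sum_filter]
  refine Finset.sum_congr rfl fun k _ ↦ ?_
  by_cases hkp : k.Prime
  · rw [if_pos hkp]
    simp only [primeCoeff, if_pos hkp, weight]
    have hk2 : (2 : ℝ) ≤ k := by exact_mod_cast hkp.two_le
    have hk0 : (k : ℂ) ≠ 0 := by exact_mod_cast hkp.ne_zero
    have hk0' : (k : ℝ) ≠ 0 := by exact_mod_cast hkp.ne_zero
    have hlog : Real.log k ≠ 0 := (Real.log_pos (by linarith)).ne'
    have hlogc : ((Real.log k : ℝ) : ℂ) ≠ 0 := Complex.ofReal_ne_zero.2 hlog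
    rw [neg_add, Complex.cpow_add _ _ hk0, Complex.cpow_neg_one, Complex.ofReal_inv, Complex.ofReal_mul,
      Complex.ofReal_natCast]
    field_simp
  · rw [if_neg hkp, primeCoeff_of_not_prime χ t hkp, mul_zero]

/-! ### The prime powers: `ψ(u) − ϑ(u) ≤ ε u` at the scale -/

/-- For `u ≥ e^{L}/2` (`L = (log X)^θ ≥ 4`) and `16 e^{−L/4} ≤ ε`: `ψ(u) − ϑ(u) ≤ 2√u log u ≤ ε u`
(`log u ≤ 4u^{1/4}`, `u^{-1/4} ≤ 2 e^{−L/4}`). [folklore] -/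
theorem psi_sub_theta_le_of_scale {L ε u : ℝ} (hL : 4 ≤ L) (hε : 16 * Real.exp (-(L / 4)) ≤ ε)
    (hu : Real.exp L / 2 ≤ u) : Chebyshev.psi u - Chebyshev.theta u ≤ ε * u := by
  have hexp : Real.exp 4 ≤ Real.exp L := Real.exp_le_exp.2 hL
  have he4 : (5 : ℝ) ≤ Real.exp 4 := by have := Real.add_one_le_exp (4 : ℝ); linarith
  have hu2 : 2 ≤ u := by linarith
  have hu1 : 1 ≤ u := by linarith
  have hu0 : 0 < u := by linarith
  refine (Chebyshev.psi_sub_theta_le hu1).trans ?_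
  have h1 : Real.log u ≤ 4 * u ^ (1 / 4 : ℝ) := by
    have := Real.log_le_rpow_div hu0.le (by norm_num : (0 : ℝ) < 1 / 4)
    rw [show u ^ (1 / 4 : ℝ) / (1 / 4) = 4 * u ^ (1 / 4 : ℝ) by ring] at this
    exact this
  have h3 : 2 * Real.sqrt u * Real.log u ≤ 8 * (u * u ^ (-(1 / 4) : ℝ)) := by
    rw [Real.sqrt_eq_rpow]
    calc 2 * u ^ (1 / 2 : ℝ) * Real.log u ≤ 2 * u ^ (1 / 2 : ℝ) * (4 * u ^ (1 / 4 : ℝ)) := by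
          gcongr
      _ = 8 * (u ^ (1 / 2 : ℝ) * u ^ (1 / 4 : ℝ)) := by ring
      _ = 8 * (u * u ^ (-(1 / 4) : ℝ)) := by
          rw [← Real.rpow_add hu0, show (1 / 2 : ℝ) + 1 / 4 = 1 + -(1 / 4) by norm_num,
            Real.rpow_add hu0, Real.rpow_one]
  -- `u^{-1/4} ≤ 2 e^{-L/4}`
  have h4 : u ^ (-(1 / 4) : ℝ) ≤ (Real.exp L / 2) ^ (-(1 / 4) : ℝ) :=
    Real.rpow_le_rpow_of_nonpos (by positivity) hu (by norm_num)
  have h5 : (Real.exp L / 2) ^ (-(1 / 4) : ℝ) ≤ 2 * Real.exp (-(L / 4)) := by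
    rw [Real.div_rpow (Real.exp_pos _).le (by norm_num), ← Real.exp_mul,
      show L * (-(1 / 4) : ℝ) = -(L / 4) by ring]
    have h6 : (1 / 2 : ℝ) ≤ (2 : ℝ) ^ (-(1 / 4) : ℝ) := by
      rw [Real.rpow_neg (by norm_num), one_div, inv_le_inv₀ (by positivity) (by positivity)]
      calc (2 : ℝ) ^ (1 / 4 : ℝ) ≤ (2 : ℝ) ^ (1 : ℝ) :=
            Real.rpow_le_rpow_of_exponent_le (by norm_num) (by norm_num)
        _ = 2 := Real.rpow_one 2
    calc Real.exp (-(L / 4)) / (2 : ℝ) ^ (-(1 / 4) : ℝ) ≤ Real.exp (-(L / 4)) / (1 / 2) :=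
          div_le_div_of_nonneg_left (Real.exp_pos _).le (by norm_num) h6
      _ = 2 * Real.exp (-(L / 4)) := by ring
  calc 2 * Real.sqrt u * Real.log u ≤ 8 * (u * u ^ (-(1 / 4) : ℝ)) := h3
    _ ≤ 8 * (u * (2 * Real.exp (-(L / 4)))) := by gcongr; exact h4.trans h5
    _ = (16 * Real.exp (-(L / 4))) * u := by ring
    _ ≤ ε * u := mul_le_mul_of_nonneg_right hε hu0.le

/-! ### Lemma 4.5 for large `X` -/

set_option maxHeartbeats 1600000 in
/-- **Lemma 4.5 at large scales, with the absolute constant `16`, from ANY Vinogradov–Korobov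
region** `HasVKZeroFreeRegion c T₀` (`c > 0`, any starting height `T₀`; the inexplicit interface of
`VinogradovKorobovDirichlet.lean`).  For `A, K > 0`, `θ > 2/3`: for all large `X`, all
`q ≤ (log X)^A`, all `χ` mod `q`, all `exp((log X)^θ) ≤ P ≤ Q ≤ X` and `|t| ≤ X`,
`‖∑_{P ≤ p ≤ Q} χ(p) p^{-1-it}‖ ≤ 16 (log X/(1 + |t|) + (log X)^{-K})`.
Abel summation with `f(u) = 1/(u log u)` on `[⌈P⌉ − 1, ⌊Q⌋]` against the prime sums
`D(u) = ∑_{p ≤ u} χ(p) log p · p^{-it}`, `‖D(u)‖ ≤ κu`, `κ = 2/(1+|t|) + 2(log X)^{-K-2}`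
(`TwistedVonMangoldt.twisted_sum_estimate_of_vk` and `ψ − ϑ ≤ 2√u log u`).  The Khale form is
`eventually_primeCharSum_le` below. [cite: Lichtman2020, Lemma 4.5] -/
theorem eventually_primeCharSum_le_of_vk {cVK TVK : ℝ} (hcVK : 0 < cVK)
    (hVK : HasVKZeroFreeRegion cVK TVK) {A K θ : ℝ} (hA : 0 < A) (hK0 : 0 < K) (hθ : 2 / 3 < θ) :
    ∀ᶠ X : ℝ in atTop, ∀ (q : ℕ) [NeZero q], (q : ℝ) ≤ Real.log X ^ A →
      ∀ (χ : DirichletCharacter ℂ q) (P Q : ℝ), Real.exp (Real.log X ^ θ) ≤ P → P ≤ Q → Q ≤ X →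
        ∀ t : ℝ, |t| ≤ X →
          ‖∑ p ∈ (Finset.Icc ⌈P⌉₊ ⌊Q⌋₊).filter Nat.Prime,
              χ (p : ZMod q) * (p : ℂ) ^ (-(1 + (t : ℂ) * I))‖ ≤
            16 * (Real.log X / (1 + |t|) + Real.log X ^ (-K)) := by
  have hθ0 : 0 < θ := by linarith
  filter_upwards [twisted_sum_estimate_of_vk hcVK hVK hA hθ (K := K + 2) (by linarith),
    Real.tendsto_log_atTop.eventually_ge_atTop (1 : ℝ),
    ((tendsto_rpow_atTop hθ0).comp Real.tendsto_log_atTop).eventually_ge_atTop (4 : ℝ),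
    eventually_mul_log_rpow_le_exp 16 (K + 2) (show (0 : ℝ) < 1 / 4 by norm_num) hθ0,
    eventually_gt_atTop (0 : ℝ)] with X htw hℓ1 hℓθ hEψ hX0
  intro q _ hqA χ P Q hP hPQ hQX t ht
  set ℓ : ℝ := Real.log X with hℓdef
  have hℓ0 : 0 < ℓ := by linarith
  have hℓθ' : (4 : ℝ) ≤ ℓ ^ θ := by simpa using hℓθ
  set ε : ℝ := ℓ ^ (-(K + 2)) with hεdef
  have hε0 : 0 < ε := Real.rpow_pos_of_pos hℓ0 _
  set κ : ℝ := 2 / (1 + |t|) + 2 * ε with hκdef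
  have hκ0 : 0 ≤ κ := by positivity
  -- `16 e^{-ℓ^θ/4} ≤ ε`
  have hεψ : 16 * Real.exp (-(ℓ ^ θ / 4)) ≤ ε := by
    have hprod : ℓ ^ (K + 2) * ε = 1 := by
      rw [hεdef, ← Real.rpow_add hℓ0, add_neg_cancel, Real.rpow_zero]
    have h1 := mul_le_mul_of_nonneg_right hEψ (show 0 ≤ Real.exp (-(ℓ ^ θ / 4)) * ε by positivity)
    have h2 : 16 * ℓ ^ (K + 2) * (Real.exp (-(ℓ ^ θ / 4)) * ε) =
        16 * Real.exp (-(ℓ ^ θ / 4)) * (ℓ ^ (K + 2) * ε) := by ring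
    have h3 : Real.exp (1 / 4 * ℓ ^ θ) * (Real.exp (-(ℓ ^ θ / 4)) * ε) = ε := by
      rw [← mul_assoc, ← Real.exp_add, show 1 / 4 * ℓ ^ θ + -(ℓ ^ θ / 4) = 0 by ring, Real.exp_zero,
        one_mul]
    rw [h2, hprod, mul_one, h3] at h1
    exact h1
  -- `P`, `n`, `m`
  have he4 : (5 : ℝ) ≤ Real.exp 4 := by have := Real.add_one_le_exp (4 : ℝ); linarith
  have hexpP : Real.exp 4 ≤ P := (Real.exp_le_exp.2 hℓθ').trans hP
  have hP5 : 5 ≤ P := he4.trans hexpP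
  have hP0 : 0 < P := by linarith
  rw [sum_primes_eq_sum_weight_mul χ t hP0 Q]
  set n : ℕ := ⌈P⌉₊ - 1 with hndef
  set m : ℕ := ⌊Q⌋₊ with hmdef
  have hn1 : 1 ≤ ⌈P⌉₊ := Nat.ceil_pos.2 hP0
  have hncast : (n : ℝ) = ⌈P⌉₊ - 1 := by rw [hndef, Nat.cast_sub hn1, Nat.cast_one]
  have hnP : P - 1 ≤ n := by rw [hncast]; linarith [Nat.le_ceil P]
  have hnhalf : P / 2 ≤ n := by linarith
  have hn_ge : Real.exp (ℓ ^ θ) / 2 ≤ n := by linarith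
  have hn2 : (2 : ℝ) ≤ n := by linarith
  have hn0 : (0 : ℝ) < n := by linarith
  have hmQ : (m : ℝ) ≤ Q := Nat.floor_le (by linarith)
  have hmX : (m : ℝ) ≤ X := hmQ.trans hQX
  have hnm : n ≤ m := by
    have h1 : (⌈P⌉₊ : ℝ) < P + 1 := Nat.ceil_lt_add_one hP0.le
    have h2 : Q < (⌊Q⌋₊ : ℝ) + 1 := Nat.lt_floor_add_one Q
    have h3 : (⌈P⌉₊ : ℝ) < (⌊Q⌋₊ : ℝ) + 2 := by linarith
    have h4 : ⌈P⌉₊ < ⌊Q⌋₊ + 2 := by exact_mod_cast h3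
    omega
  have hnmR : (n : ℝ) ≤ m := by exact_mod_cast hnm
  have hm0 : (0 : ℝ) < m := by linarith
  -- logarithms
  have hlog2 : Real.log 2 ≤ 1 := by
    have := Real.log_le_sub_one_of_pos (show (0 : ℝ) < 2 by norm_num); linarith
  have hlogn : ℓ ^ θ / 2 ≤ Real.log n := by
    have h1 : Real.log (Real.exp (ℓ ^ θ) / 2) = ℓ ^ θ - Real.log 2 := by
      rw [Real.log_div (Real.exp_pos _).ne' (by norm_num), Real.log_exp]
    have h2 : Real.log (Real.exp (ℓ ^ θ) / 2) ≤ Real.log n := Real.log_le_log (by positivity) hn_ge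
    linarith
  have hlogn1 : 1 ≤ Real.log n := by linarith
  have hlogn0 : 0 < Real.log n := by linarith
  have hlogm : Real.log n ≤ Real.log m := Real.log_le_log hn0 hnmR
  have hlogm0 : 0 < Real.log m := by linarith
  have hlogmn : Real.log ((m : ℝ) / n) ≤ ℓ := by
    have h1 : (m : ℝ) / n ≤ X := by
      rw [div_le_iff₀ hn0]
      calc (m : ℝ) ≤ X := hmX
        _ = X * 1 := (mul_one X).symm
        _ ≤ X * n := by gcongr; linarith
    exact Real.log_le_log (by positivity) h1
  -- `‖D(u)‖ ≤ κ u` on `[n, m]`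
  have hDb : ∀ u : ℝ, (n : ℝ) ≤ u → u ≤ m →
      ‖∑ k ∈ Finset.Icc 0 ⌊u⌋₊, primeCoeff χ t k‖ ≤ κ * u := by
    intro u hu1 hu2
    have hulo : Real.exp (ℓ ^ θ) / 2 ≤ u := hn_ge.trans hu1
    have huX : u ≤ X := hu2.trans hmX
    have hu0 : 0 < u := by linarith
    exact norm_sum_primeCoeff_le χ t hu0 (htw q hqA χ t ht u hulo huX)
      (psi_sub_theta_le_of_scale hℓθ' hεψ hulo)
  -- Abel summation
  have hf_diff : ∀ u ∈ Set.Icc (n : ℝ) m, DifferentiableAt ℝ (fun u : ℝ ↦ ((weight u : ℝ) : ℂ)) u :=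
    fun u hu ↦ (hasDerivAt_weightC (by linarith [hu.1] : 1 < u)).differentiableAt
  have hderiv : ∀ u ∈ Set.Icc (n : ℝ) m, deriv (fun u : ℝ ↦ ((weight u : ℝ) : ℂ)) u =
      (((-(Real.log u + 1) / (u * Real.log u) ^ 2 : ℝ)) : ℂ) :=
    fun u hu ↦ (hasDerivAt_weightC (by linarith [hu.1] : 1 < u)).deriv
  have hcontR : ContinuousOn (fun u : ℝ ↦ -(Real.log u + 1) / (u * Real.log u) ^ 2) (Set.Icc (n : ℝ) m) := by
    have hlogc : ContinuousOn Real.log (Set.Icc (n : ℝ) m) :=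
      Real.continuousOn_log.mono fun u hu ↦ by
        simp only [Set.mem_compl_iff, Set.mem_singleton_iff]
        exact (by linarith [hu.1] : (0 : ℝ) < u).ne'
    refine ContinuousOn.div ((hlogc.add continuousOn_const).neg) ((continuousOn_id.mul hlogc).pow 2) ?_
    intro u hu
    have hu1 : 1 < u := by linarith [hu.1]
    exact pow_ne_zero 2 (mul_ne_zero (by linarith) (Real.log_pos hu1).ne')
  have hf_int : IntegrableOn (deriv (fun u : ℝ ↦ ((weight u : ℝ) : ℂ))) (Set.Icc (n : ℝ) m) := by
    have hcont : ContinuousOn (fun u : ℝ ↦ (((-(Real.log u + 1) / (u * Real.log u) ^ 2 : ℝ)) : ℂ))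
        (Set.Icc (n : ℝ) m) := Complex.continuous_ofReal.comp_continuousOn hcontR
    exact (hcont.integrableOn_Icc).congr_fun (fun u hu ↦ (hderiv u hu).symm) measurableSet_Icc
  have hAbel : ∑ k ∈ Finset.Ioc n m, ((weight k : ℝ) : ℂ) * primeCoeff χ t k =
      ((weight m : ℝ) : ℂ) * (∑ k ∈ Finset.Icc 0 m, primeCoeff χ t k) -
        ((weight n : ℝ) : ℂ) * (∑ k ∈ Finset.Icc 0 n, primeCoeff χ t k) -
        ∫ u in Set.Ioc (n : ℝ) m, deriv (fun u : ℝ ↦ ((weight u : ℝ) : ℂ)) u *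
          ∑ k ∈ Finset.Icc 0 ⌊u⌋₊, primeCoeff χ t k :=
    sum_mul_eq_sub_sub_integral_mul' (primeCoeff χ t) hnm hf_diff hf_int
  rw [hAbel]
  -- the boundary terms
  have hwm : ‖((weight m : ℝ) : ℂ) * ∑ k ∈ Finset.Icc 0 m, primeCoeff χ t k‖ ≤ κ / Real.log n := by
    have hD := hDb m hnmR le_rfl
    rw [Nat.floor_natCast] at hD
    rw [norm_mul, Complex.norm_real, Real.norm_eq_abs, weight, abs_of_pos (by positivity)]
    calc ((m : ℝ) * Real.log m)⁻¹ * ‖∑ k ∈ Finset.Icc 0 m, primeCoeff χ t k‖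
        ≤ ((m : ℝ) * Real.log m)⁻¹ * (κ * m) := mul_le_mul_of_nonneg_left hD (by positivity)
      _ = κ / Real.log m := by field_simp
      _ ≤ κ / Real.log n := div_le_div_of_nonneg_left hκ0 hlogn0 hlogm
  have hwn : ‖((weight n : ℝ) : ℂ) * ∑ k ∈ Finset.Icc 0 n, primeCoeff χ t k‖ ≤ κ / Real.log n := by
    have hD := hDb n le_rfl hnmR
    rw [Nat.floor_natCast] at hD
    rw [norm_mul, Complex.norm_real, Real.norm_eq_abs, weight, abs_of_pos (by positivity)]
    calc ((n : ℝ) * Real.log n)⁻¹ * ‖∑ k ∈ Finset.Icc 0 n, primeCoeff χ t k‖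
        ≤ ((n : ℝ) * Real.log n)⁻¹ * (κ * n) := mul_le_mul_of_nonneg_left hD (by positivity)
      _ = κ / Real.log n := by field_simp
  -- the integral term
  set g : ℝ → ℝ := fun u ↦ 2 * κ / Real.log n * u⁻¹ with hgdef
  have hgcont : ContinuousOn g (Set.Icc (n : ℝ) m) := by
    refine ContinuousOn.mul continuousOn_const (continuousOn_inv₀.comp continuousOn_id fun u hu ↦ ?_)
    exact (by linarith [hu.1] : (0 : ℝ) < u).ne'
  have hgi : IntegrableOn g (Set.Ioc (n : ℝ) m) :=
    (hgcont.integrableOn_Icc).mono_set Set.Ioc_subset_Icc_self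
  have hbound : ∀ᵐ u : ℝ ∂(volume.restrict (Set.Ioc (n : ℝ) m)),
      ‖deriv (fun u : ℝ ↦ ((weight u : ℝ) : ℂ)) u * ∑ k ∈ Finset.Icc 0 ⌊u⌋₊, primeCoeff χ t k‖ ≤ g u := by
    refine (ae_restrict_iff' measurableSet_Ioc).2 (Eventually.of_forall fun u hu ↦ ?_)
    have hu1 : (n : ℝ) < u := hu.1
    have hu2 : u ≤ m := hu.2
    have hu0 : 0 < u := by linarith
    have hlogu : Real.log n ≤ Real.log u := Real.log_le_log hn0 hu1.le
    have hlogu1 : 1 ≤ Real.log u := hlogn1.trans hlogu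
    rw [hderiv u ⟨hu1.le, hu2⟩, norm_mul]
    have h1 := norm_deriv_weight_le (by linarith : 1 < u) hlogu1
    have h2 := hDb u hu1.le hu2
    calc ‖(((-(Real.log u + 1) / (u * Real.log u) ^ 2 : ℝ)) : ℂ)‖ *
          ‖∑ k ∈ Finset.Icc 0 ⌊u⌋₊, primeCoeff χ t k‖
        ≤ 2 / (u ^ 2 * Real.log u) * (κ * u) :=
          mul_le_mul h1 h2 (norm_nonneg _) (by positivity)
      _ = 2 * κ / Real.log u * u⁻¹ := by field_simp
      _ ≤ 2 * κ / Real.log n * u⁻¹ := by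
          gcongr
      _ = g u := rfl
  have hint : ‖∫ u in Set.Ioc (n : ℝ) m, deriv (fun u : ℝ ↦ ((weight u : ℝ) : ℂ)) u *
      ∑ k ∈ Finset.Icc 0 ⌊u⌋₊, primeCoeff χ t k‖ ≤ 2 * κ * ℓ / Real.log n := by
    refine (norm_integral_le_of_norm_le hgi hbound).trans ?_
    rw [← intervalIntegral.integral_of_le hnmR, hgdef, intervalIntegral.integral_const_mul,
      integral_inv_of_pos hn0 hm0]
    calc 2 * κ / Real.log n * Real.log ((m : ℝ) / n) ≤ 2 * κ / Real.log n * ℓ :=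
          mul_le_mul_of_nonneg_left hlogmn (by positivity)
      _ = 2 * κ * ℓ / Real.log n := by ring
  -- assemble
  have htotal : κ / Real.log n + κ / Real.log n + 2 * κ * ℓ / Real.log n ≤ 8 * κ * ℓ ^ (1 - θ) := by
    have h1 : κ / Real.log n + κ / Real.log n + 2 * κ * ℓ / Real.log n ≤ 4 * κ * ℓ / Real.log n := by
      rw [← add_div, ← add_div, div_le_div_iff_of_pos_right hlogn0]
      nlinarith [mul_nonneg hκ0 (by linarith : (0 : ℝ) ≤ ℓ - 1)]
    have h2 : 4 * κ * ℓ / Real.log n ≤ 4 * κ * ℓ / (ℓ ^ θ / 2) :=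
      div_le_div_of_nonneg_left (by positivity) (by positivity) hlogn
    have h3 : 4 * κ * ℓ / (ℓ ^ θ / 2) = 8 * κ * ℓ ^ (1 - θ) := by
      rw [Real.rpow_sub hℓ0, Real.rpow_one]
      field_simp
      ring
    linarith
  have hfinal : 8 * κ * ℓ ^ (1 - θ) ≤ 16 * (ℓ / (1 + |t|) + ℓ ^ (-K)) := by
    have h1 : ℓ ^ (1 - θ) ≤ ℓ := by
      calc ℓ ^ (1 - θ) ≤ ℓ ^ (1 : ℝ) := Real.rpow_le_rpow_of_exponent_le hℓ1 (by linarith)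
        _ = ℓ := Real.rpow_one ℓ
    have h2 : ε * ℓ ^ (1 - θ) ≤ ℓ ^ (-K) := by
      rw [hεdef, ← Real.rpow_add hℓ0]
      exact Real.rpow_le_rpow_of_exponent_le hℓ1 (by linarith)
    have h3 : 0 ≤ 1 + |t| := by positivity
    have h4 : 2 / (1 + |t|) * ℓ ^ (1 - θ) ≤ 2 * (ℓ / (1 + |t|)) := by
      rw [div_mul_eq_mul_div, mul_div_assoc]
      exact mul_le_mul_of_nonneg_left (div_le_div_of_nonneg_right h1 h3) (by norm_num)
    calc 8 * κ * ℓ ^ (1 - θ) = 8 * (2 / (1 + |t|) * ℓ ^ (1 - θ)) + 16 * (ε * ℓ ^ (1 - θ)) := by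
          rw [hκdef]; ring
      _ ≤ 8 * (2 * (ℓ / (1 + |t|))) + 16 * ℓ ^ (-K) := by gcongr
      _ = 16 * (ℓ / (1 + |t|) + ℓ ^ (-K)) := by ring
  calc ‖((weight m : ℝ) : ℂ) * (∑ k ∈ Finset.Icc 0 m, primeCoeff χ t k) -
        ((weight n : ℝ) : ℂ) * (∑ k ∈ Finset.Icc 0 n, primeCoeff χ t k) -
        ∫ u in Set.Ioc (n : ℝ) m, deriv (fun u : ℝ ↦ ((weight u : ℝ) : ℂ)) u *
          ∑ k ∈ Finset.Icc 0 ⌊u⌋₊, primeCoeff χ t k‖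
      ≤ ‖((weight m : ℝ) : ℂ) * ∑ k ∈ Finset.Icc 0 m, primeCoeff χ t k‖ +
          ‖((weight n : ℝ) : ℂ) * ∑ k ∈ Finset.Icc 0 n, primeCoeff χ t k‖ +
          ‖∫ u in Set.Ioc (n : ℝ) m, deriv (fun u : ℝ ↦ ((weight u : ℝ) : ℂ)) u *
            ∑ k ∈ Finset.Icc 0 ⌊u⌋₊, primeCoeff χ t k‖ := by
        calc _ ≤ ‖((weight m : ℝ) : ℂ) * (∑ k ∈ Finset.Icc 0 m, primeCoeff χ t k) -
              ((weight n : ℝ) : ℂ) * (∑ k ∈ Finset.Icc 0 n, primeCoeff χ t k)‖ + _ := norm_sub_le _ _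
          _ ≤ _ := by gcongr; exact norm_sub_le _ _
    _ ≤ κ / Real.log n + κ / Real.log n + 2 * κ * ℓ / Real.log n := add_le_add (add_le_add hwm hwn) hint
    _ ≤ 8 * κ * ℓ ^ (1 - θ) := htotal
    _ ≤ 16 * (ℓ / (1 + |t|) + ℓ ^ (-K)) := hfinal

/-! ### Lemma 4.5 -/

omit [NeZero q] in
/-- The trivial bound `‖∑_{P ≤ p ≤ Q} χ(p)p^{-1-it}‖ ≤ X` (`#` of terms `≤ ⌊Q⌋ ≤ X`, each of modulus
`p^{-1} ≤ 1`; `P > 0`, `0 ≤ Q ≤ X`). [folklore] -/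
theorem norm_primeSum_le (χ : DirichletCharacter ℂ q) (t : ℝ) {P Q X : ℝ} (hP : 0 < P) (hQ : 0 ≤ Q)
    (hQX : Q ≤ X) :
    ‖∑ p ∈ (Finset.Icc ⌈P⌉₊ ⌊Q⌋₊).filter Nat.Prime, χ (p : ZMod q) * (p : ℂ) ^ (-(1 + (t : ℂ) * I))‖ ≤
      X := by
  have hn1 : 1 ≤ ⌈P⌉₊ := Nat.ceil_pos.2 hP
  have hterm : ∀ p ∈ (Finset.Icc ⌈P⌉₊ ⌊Q⌋₊).filter Nat.Prime,
      ‖χ (p : ZMod q) * (p : ℂ) ^ (-(1 + (t : ℂ) * I))‖ ≤ 1 := by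
    intro p hp
    have hpp : p.Prime := (Finset.mem_filter.1 hp).2
    have hp1 : (1 : ℝ) ≤ p := by exact_mod_cast hpp.one_lt.le
    rw [norm_mul, Complex.norm_natCast_cpow_of_pos hpp.pos]
    have hre : (-(1 + (t : ℂ) * I)).re = -1 := by simp
    rw [hre]
    calc ‖χ (p : ZMod q)‖ * (p : ℝ) ^ (-1 : ℝ) ≤ 1 * 1 := by
          refine mul_le_mul (DirichletCharacter.norm_le_one χ _) ?_ (by positivity) zero_le_one
          exact Real.rpow_le_one_of_one_le_of_nonpos hp1 (by norm_num)
      _ = 1 := one_mul _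
  calc ‖∑ p ∈ (Finset.Icc ⌈P⌉₊ ⌊Q⌋₊).filter Nat.Prime, χ (p : ZMod q) * (p : ℂ) ^ (-(1 + (t : ℂ) * I))‖
      ≤ ∑ p ∈ (Finset.Icc ⌈P⌉₊ ⌊Q⌋₊).filter Nat.Prime, (1 : ℝ) :=
        (norm_sum_le _ _).trans (Finset.sum_le_sum hterm)
    _ = ((Finset.Icc ⌈P⌉₊ ⌊Q⌋₊).filter Nat.Prime).card := by simp
    _ ≤ (Finset.Icc ⌈P⌉₊ ⌊Q⌋₊).card := by exact_mod_cast Finset.card_filter_le _ _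
    _ = ((⌊Q⌋₊ + 1 - ⌈P⌉₊ : ℕ) : ℝ) := by rw [Nat.card_Icc]
    _ ≤ (⌊Q⌋₊ : ℝ) := by
        have : ⌊Q⌋₊ + 1 - ⌈P⌉₊ ≤ ⌊Q⌋₊ := by omega
        exact_mod_cast this
    _ ≤ Q := Nat.floor_le hQ
    _ ≤ X := hQX

/-- **Lichtman 2020, Lemma 4.5, from ANY Vinogradov–Korobov region** `HasVKZeroFreeRegion c T₀`
(`c > 0`).  The named fact `Lichtman2020_primeCharacterSum` (for `A, K > 0`, `θ > 2/3` there is `C`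
with `‖∑_{P ≤ p ≤ Q} χ(p) p^{-1-it}‖ ≤ C (log X/(1 + |t|) + (log X)^{-K})` for all `X ≥ 2`,
`1 ≤ q ≤ (log X)^A`, `χ` mod `q`, `exp((log X)^θ) ≤ P ≤ Q ≤ X`, `|t| ≤ X`) follows from a
Vinogradov–Korobov zero-free region for Dirichlet `L`-functions with any constant and any starting
height: large `X` by `eventually_primeCharSum_le_of_vk` (constant `16`), small `X` by the trivial
bound `norm_primeSum_le` (constant `X₁(1 + X₁)/log 2`).  The Khale form is
`Lichtman2020_primeCharacterSum_of_khale` below. [cite: Lichtman2020, Lemma 4.5] -/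
theorem Lichtman2020_primeCharacterSum_of_vk {cVK TVK : ℝ} (hcVK : 0 < cVK)
    (hVK : HasVKZeroFreeRegion cVK TVK) : Lichtman2020_primeCharacterSum := by
  intro A K θ hA hK0 hθ
  obtain ⟨X₀, hX₀⟩ := Filter.eventually_atTop.1 (eventually_primeCharSum_le_of_vk hcVK hVK hA hK0 hθ)
  set X₁ : ℝ := max X₀ 2 with hX₁
  have hX₁2 : 2 ≤ X₁ := le_max_right _ _
  have hX₁0 : 0 < X₁ := by linarith
  have hlog2 : 0 < Real.log 2 := Real.log_pos one_lt_two
  refine ⟨max 16 (X₁ * (1 + X₁) / Real.log 2), ?_⟩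
  intro X hX q hq hqA χ P Q hP hPQ hQX t ht
  have hlogX : Real.log 2 ≤ Real.log X := Real.log_le_log two_pos hX
  have hlogX0 : 0 ≤ Real.log X := hlog2.le.trans hlogX
  have hpos : 0 ≤ Real.log X / (1 + |t|) + Real.log X ^ (-K) := by positivity
  have hP0 : 0 < P := lt_of_lt_of_le (Real.exp_pos _) hP
  rcases le_or_gt X₁ X with hXX | hXX
  · haveI : NeZero q := ⟨Nat.one_le_iff_ne_zero.mp hq⟩
    have h := hX₀ X ((le_max_left _ _).trans hXX) q hqA χ P Q hP hPQ hQX t ht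
    exact h.trans (mul_le_mul_of_nonneg_right (le_max_left _ _) hpos)
  · have hS := norm_primeSum_le χ t hP0 (hP0.le.trans hPQ) hQX
    have h1 : X ≤ X₁ := hXX.le
    have htX : 1 + |t| ≤ 1 + X₁ := by linarith
    have h2 : Real.log 2 / (1 + X₁) ≤ Real.log X / (1 + |t|) :=
      div_le_div₀ hlogX0 hlogX (by positivity) htX
    calc _ ≤ X := hS
      _ ≤ X₁ := h1
      _ = (X₁ * (1 + X₁) / Real.log 2) * (Real.log 2 / (1 + X₁)) := by
          field_simp
      _ ≤ (X₁ * (1 + X₁) / Real.log 2) * (Real.log X / (1 + |t|)) :=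
          mul_le_mul_of_nonneg_left h2 (by positivity)
      _ ≤ (X₁ * (1 + X₁) / Real.log 2) * (Real.log X / (1 + |t|) + Real.log X ^ (-K)) := by
          refine mul_le_mul_of_nonneg_left ?_ (by positivity)
          have : 0 ≤ Real.log X ^ (-K) := by positivity
          linarith
      _ ≤ max 16 (X₁ * (1 + X₁) / Real.log 2) * (Real.log X / (1 + |t|) + Real.log X ^ (-K)) :=
          mul_le_mul_of_nonneg_right (le_max_right _ _) hpos

set_option maxHeartbeats 400000 in
/-- **Lemma 4.5 at large scales, with the absolute constant `16`.**  Assume Khale's theorem.  For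
`A, K > 0`, `θ > 2/3`: for all large `X`, all `q ≤ (log X)^A`, all `χ` mod `q`, all
`exp((log X)^θ) ≤ P ≤ Q ≤ X` and `|t| ≤ X`,
`‖∑_{P ≤ p ≤ Q} χ(p) p^{-1-it}‖ ≤ 16 (log X/(1 + |t|) + (log X)^{-K})`.
Khale's Theorem 1.1 (1.2) is `HasVKZeroFreeRegion (1/61.5) 10` (`hasVKZeroFreeRegion_of_khale`), so
this is `eventually_primeCharSum_le_of_vk`. [cite: Lichtman2020, Lemma 4.5]
[cite: Khale2024, Theorem 1.1] -/
theorem eventually_primeCharSum_le (hK : Khale2024_zeroFreeRegion) {A K θ : ℝ} (hA : 0 < A)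
    (hK0 : 0 < K) (hθ : 2 / 3 < θ) :
    ∀ᶠ X : ℝ in atTop, ∀ (q : ℕ) [NeZero q], (q : ℝ) ≤ Real.log X ^ A →
      ∀ (χ : DirichletCharacter ℂ q) (P Q : ℝ), Real.exp (Real.log X ^ θ) ≤ P → P ≤ Q → Q ≤ X →
        ∀ t : ℝ, |t| ≤ X →
          ‖∑ p ∈ (Finset.Icc ⌈P⌉₊ ⌊Q⌋₊).filter Nat.Prime,
              χ (p : ZMod q) * (p : ℂ) ^ (-(1 + (t : ℂ) * I))‖ ≤
            16 * (Real.log X / (1 + |t|) + Real.log X ^ (-K)) :=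
  eventually_primeCharSum_le_of_vk (by norm_num) (hasVKZeroFreeRegion_of_khale hK) hA hK0 hθ

/-- **Lichtman 2020, Lemma 4.5, from Khale's Theorem 1.1.**  The named fact
`Lichtman2020_primeCharacterSum` follows from the explicit Vinogradov–Korobov zero-free region for
Dirichlet `L`-functions (`Khale2024_zeroFreeRegion`, which is `HasVKZeroFreeRegion (1/61.5) 10`):
`Lichtman2020_primeCharacterSum_of_vk`. [cite: Lichtman2020, Lemma 4.5]
[cite: Khale2024, Theorem 1.1] -/
theorem Lichtman2020_primeCharacterSum_of_khale (hK : Khale2024_zeroFreeRegion) :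
    Lichtman2020_primeCharacterSum :=
  Lichtman2020_primeCharacterSum_of_vk (by norm_num) (hasVKZeroFreeRegion_of_khale hK)

end Lichtman2020.PrimeCharSum

/-! ### Theorem 1.1 from Khale's theorem -/

open Literature.NumberTheory.LFunctions in
/-- **Lichtman 2020, Theorem 1.1 (power range) ⇐ Khale's Theorem 1.1 + Lemma 4.8**, the older
conditional form through `MoebiusShiftedPrimesMinorArcWith.lean`
(`lichtman2020_moebius_shifted_primes_avg_power_of_primeCharacterSum_of_liouvilleCharacterSifted`),
with Lemma 4.5 supplied by `Lichtman2020.PrimeCharSum.Lichtman2020_primeCharacterSum_of_khale`.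
Lemma 4.8 (`Lichtman2020_liouvilleCharacterSifted`) is itself proved in the tree
(`Lichtman2020_liouvilleCharacterSifted_holds` below), so the hypothesis `h48` can be discharged:
see `lichtman2020_moebius_shifted_primes_avg_power_of_khale`.
[cite: Lichtman2020, Theorem 1.1] [cite: Khale2024, Theorem 1.1] -/
theorem lichtman2020_moebius_shifted_primes_avg_power_of_khale_of_liouvilleCharacterSifted
    (hK : Khale2024_zeroFreeRegion) (h48 : Lichtman2020_liouvilleCharacterSifted) :
    lichtman2020_moebius_shifted_primes_avg_power :=
  lichtman2020_moebius_shifted_primes_avg_power_of_primeCharacterSum_of_liouvilleCharacterSifted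
    (Lichtman2020.PrimeCharSum.Lichtman2020_primeCharacterSum_of_khale hK) h48

open Literature.NumberTheory.LFunctions in
/-- **Lichtman 2020, Theorem 1.1 (power range) ⇐ Khale's Theorem 1.1 + Siegel–Walfisz for `μ`**: the
closing statement of `MoebiusShiftedPrimesAvgFinal.lean`
(`lichtman2020_moebius_shifted_primes_avg_power_of_primeCharacterSum_of_siegelWalfiszMoebius`, which
supplies Lemma 4.8 through `Lichtman2020_liouvilleCharacterSifted_of_siegelWalfiszMoebius`) with
Lemma 4.5 supplied by `Lichtman2020.PrimeCharSum.Lichtman2020_primeCharacterSum_of_khale`.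
[cite: Lichtman2020, Theorem 1.1] [cite: Khale2024, Theorem 1.1] -/
theorem lichtman2020_moebius_shifted_primes_avg_power_of_khale_of_siegelWalfiszMoebius
    (hK : Khale2024_zeroFreeRegion) (hSW : SiegelWalfiszMoebius) :
    lichtman2020_moebius_shifted_primes_avg_power :=
  lichtman2020_moebius_shifted_primes_avg_power_of_primeCharacterSum_of_siegelWalfiszMoebius
    (Lichtman2020.PrimeCharSum.Lichtman2020_primeCharacterSum_of_khale hK) hSW

open Literature.NumberTheory.LFunctions in
/-- **Lichtman 2020, Theorem 1.1 (qualitative part) ⇐ Khale's Theorem 1.1 + Siegel–Walfisz for `μ`**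
(`lichtman2020_moebius_shifted_primes_avg_of_primeCharacterSum_of_siegelWalfiszMoebius` of
`MoebiusShiftedPrimesAvgFinal.lean` with Lemma 4.5 from Khale's theorem).
[cite: Lichtman2020, Theorem 1.1] [cite: Khale2024, Theorem 1.1] -/
theorem lichtman2020_moebius_shifted_primes_avg_of_khale_of_siegelWalfiszMoebius
    (hK : Khale2024_zeroFreeRegion) (hSW : SiegelWalfiszMoebius) :
    lichtman2020_moebius_shifted_primes_avg :=
  lichtman2020_moebius_shifted_primes_avg_of_primeCharacterSum_of_siegelWalfiszMoebius
    (Lichtman2020.PrimeCharSum.Lichtman2020_primeCharacterSum_of_khale hK) hSW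

open Literature.NumberTheory.LFunctions in
/-- **Lemma 4.8 of Lichtman 2020, PROVED** (fundamental lemma + Siegel–Walfisz for `λχ`): the named
fact `Lichtman2020_liouvilleCharacterSifted` holds, by the tree's
`Lichtman2020_liouvilleCharacterSifted_of_siegelWalfiszMoebius` (`LiouvilleSiftedCharSum.lean`) and
`SiegelWalfiszMoebius_holds` (`SiegelWalfiszMoebiusProofs.lean`, MV §11.3 Exercises 8, 13).
[cite: Lichtman2020, Lemma 4.8] [cite: MontgomeryVaughan2007, §11.3 Exercise 13(f) p. 384] -/
theorem Lichtman2020_liouvilleCharacterSifted_holds : Lichtman2020_liouvilleCharacterSifted :=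
  Lichtman2020_liouvilleCharacterSifted_of_siegelWalfiszMoebius SiegelWalfiszMoebius_holds

open Literature.NumberTheory.LFunctions in
/-- **Lichtman 2020, Theorem 1.1 (power range `H = X^θ`) from Khale's Theorem 1.1 ALONE**:
`Khale2024_zeroFreeRegion → lichtman2020_moebius_shifted_primes_avg_power`.  After this file the
dependency frontier of the named fact `lichtman2020_moebius_shifted_primes_avg_power` is exactly the
explicit Vinogradov–Korobov zero-free region for Dirichlet `L`-functions
(`Khale2024_zeroFreeRegion`, Khale 2024 Theorem 1.1 (1.2)); every other input — the whole of
Lichtman's paper along the corrected typical sets, Lemma 4.5 by Landau's method and partial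
summation, Lemma 4.8, Siegel–Walfisz for `μ`, the Matomäki–Radziwiłł lemmas, Halász–Montgomery — is
proved in the tree. [cite: Lichtman2020, Theorem 1.1] [cite: Khale2024, Theorem 1.1] -/
theorem lichtman2020_moebius_shifted_primes_avg_power_of_khale (hK : Khale2024_zeroFreeRegion) :
    lichtman2020_moebius_shifted_primes_avg_power :=
  lichtman2020_moebius_shifted_primes_avg_power_of_khale_of_siegelWalfiszMoebius hK
    SiegelWalfiszMoebius_holds

open Literature.NumberTheory.LFunctions in
/-- **Lichtman 2020, Theorem 1.1 (qualitative part) from Khale's Theorem 1.1 ALONE**: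
`Khale2024_zeroFreeRegion → lichtman2020_moebius_shifted_primes_avg`.
[cite: Lichtman2020, Theorem 1.1] [cite: Khale2024, Theorem 1.1] -/
theorem lichtman2020_moebius_shifted_primes_avg_of_khale (hK : Khale2024_zeroFreeRegion) :
    lichtman2020_moebius_shifted_primes_avg :=
  lichtman2020_moebius_shifted_primes_avg_of_khale_of_siegelWalfiszMoebius hK SiegelWalfiszMoebius_holds

/-! ### Theorem 1.1 from any Vinogradov–Korobov region (the inexplicit interface) -/

open Literature.NumberTheory.LFunctions in
/-- **Lichtman 2020, Theorem 1.1 (power range `H = X^θ`) from ANY Vinogradov–Korobov region for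
Dirichlet `L`-functions** (`HasVKZeroFreeRegion c T₀`, `c > 0`; e.g. the inexplicit region of
Montgomery, *Ten lectures*, p. 176 = Khale (1.4)): Lemma 4.5 by `Lichtman2020_primeCharacterSum_of_vk`,
Lemma 4.8 and Siegel–Walfisz for `μ` proved in the tree.  So an inexplicit proof of the region
(Vinogradov's method with unspecified constants) discharges the fact as well.
[cite: Lichtman2020, Theorem 1.1] -/
theorem lichtman2020_moebius_shifted_primes_avg_power_of_vk {cVK TVK : ℝ} (hcVK : 0 < cVK)
    (hVK : HasVKZeroFreeRegion cVK TVK) : lichtman2020_moebius_shifted_primes_avg_power :=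
  lichtman2020_moebius_shifted_primes_avg_power_of_primeCharacterSum_of_siegelWalfiszMoebius
    (Lichtman2020.PrimeCharSum.Lichtman2020_primeCharacterSum_of_vk hcVK hVK) SiegelWalfiszMoebius_holds

open Literature.NumberTheory.LFunctions in
/-- **Lichtman 2020, Theorem 1.1 (qualitative part) from ANY Vinogradov–Korobov region for Dirichlet
`L`-functions** (`HasVKZeroFreeRegion c T₀`, `c > 0`). [cite: Lichtman2020, Theorem 1.1] -/
theorem lichtman2020_moebius_shifted_primes_avg_of_vk {cVK TVK : ℝ} (hcVK : 0 < cVK)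
    (hVK : HasVKZeroFreeRegion cVK TVK) : lichtman2020_moebius_shifted_primes_avg :=
  lichtman2020_moebius_shifted_primes_avg_of_primeCharacterSum_of_siegelWalfiszMoebius
    (Lichtman2020.PrimeCharSum.Lichtman2020_primeCharacterSum_of_vk hcVK hVK) SiegelWalfiszMoebius_holds

end Literature.NumberTheory.Sieve
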